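import Literature.AlgebraicGeometry.Pohlmann1968.WeilTypeCMSubfieldRankBound
import Literature.AlgebraicGeometry.ComplexMultiplication.PrimitiveCMTypeSimple
import Literature.FieldTheory.AlgClosed.AutomorphismExtension
import Mathlib.NumberTheory.NumberField.CMField
import Mathlib.NumberTheory.Cyclotomic.PrimitiveRoots
import Mathlib.RingTheory.RootsOfUnity.Complex
import HarnessLib

/-!
# A primitive but DEGENERATE CM type: `ℚ(ζ₂₁)` with `Φ₂₁ = {σ₁, σ₂, σ₄, σ₅, σ₈, σ₁₀}`, balanced over `ℚ(√-3)`;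
# its realisations are simple CM sixfolds with `B³ ≠ D³`

Companion of `Pohlmann1968/WeilTypeCMSubfieldExceptionalClasses` (a CM type balanced over a subfield with a complex
place is degenerate — Yanai — and, if primitive, forces exceptional Hodge classes on every realisation — the
Mumford–Pohlmann mechanism) and of `Pohlmann1968/NondegenerateCMTypeDivisorClasses` (Kubota: nondegenerate ⟹
primitive; Hazama's criterion).  This file supplies a CONCRETE INSTANCE, the smallest one among cyclotomic fields
(census of all `ℚ(ζ_N)` of degree `≤ 16`, recorded in the cell's notes; no Galois CM field of degree `8` has one):

* `K = ℚ(ζ₂₁)` (`[K:ℚ] = 12`, abelian, CM), its embeddings `σ_a : ζ₂₁ ↦ e^{2πia/21}`, `a ∈ (ℤ/21)ˣ`, on which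
  `Aut(ℂ)` acts through the cyclotomic character (`exp₂₁_comp`) and complex conjugation by `a ↦ -a`;
* the CM type `Φ₂₁ = {σ_a | a ∈ S}`, `S = {1, 2, 4, 5, 8, 10}` (`S ⊔ -S = (ℤ/21)ˣ`);
* `isPrimitive_Φ₂₁` — **`Φ₂₁` is PRIMITIVE** (the translates `uS` separate the units: a `decide` over `(ℤ/21)ˣ`,
  lifted through "every unit is the cyclotomic character of some automorphism of `ℂ`", `exists_autExp_eq`);
* `fibres_balanced_Φ₂₁` — **`Φ₂₁` is balanced over the subfield `ℚ(ζ₃) = ℚ(√-3)`** (`j₃ : ζ₃ ↦ ζ₂₁⁷`): modulo `3`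
  the exponents of `Φ₂₁` are `{1,4,10} ⊔ {2,5,8}`, three over each of the two embeddings of `ℚ(ζ₃)` — `(A, ℚ(√-3))`
  is of WEIL TYPE with multiplicities `(3,3)`;
* `not_isNondegenerate_Φ₂₁` — hence **`Φ₂₁` is DEGENERATE** (Yanai; `Rank(Φ₂₁) ≤ 6 = n`): the implication
  "nondegenerate ⟹ primitive" (Kubota) is NOT reversible — Dodson's phenomenon (degenerate primitive types exist)
  witnessed by an explicit abelian field;
* `exists_exceptional_Φ₂₁`, `isSimple_Φ₂₁`, `dim_eq_six` — **every realisation `(A, ι, θ)` of `(ℚ(ζ₂₁); Φ₂₁)` is a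
  SIMPLE abelian sixfold carrying a rational `(3,3)`-class outside `D³(A) ⊗ ℂ`** (the Weil classes of
  `(A, ℚ(√-3))`; simplicity by the tree theorem `isSimple_of_isCMTypeRealisation_of_primitive`, Shimura §8.2 Prop. 26);
* `exists_simple_sixfold_exceptionalHodgeClasses_of_cmAbelianVarietyRealised` — from the existence record
  `PicardCM.CMAbelianVarietyRealised` (Shimura §6.2 Thm. 3): **there is a simple abelian sixfold with CM by `ℚ(ζ₂₁)`
  and `B³ ≠ D³`** — the dimension-`6` analogue, with an ABELIAN CM field, of Mumford's simple fourfolds with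
  `B² ≠ D²` (Pohlmann 1968 §3; van Geemen 1994 Thm. 4.5; barrier fact
  `Barriers.HodgeConjecture.Mumford1968_simpleFourfold_exceptionalHodgeClasses`, which needs a NON-Galois octic
  field and is not touched here).

§1–§2 are generic in `n` (`rootζ n = e^{2πi/n}`, the cyclotomic character `autExp n` of `Aut(ℂ)`, exponents
`embExp n` of embeddings on an `n`-th root of unity, equivariance, conjugation, powers) and redo for all `n` the
`n = 9, 3` bookkeeping of `Pohlmann1968/ExceptionalHodgeClassesCMWeilType` (`WeilTypeWitness.autExp/embExp`).
Everything is PROVED: the definitions are explicit (`rootζ`, `autExp`, `embExp`, `exp₂₁`, `exp₃`, `units21`, `S₂₁`,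
`Φ₂₁`, `j₃`, `red3`), the finite combinatorics is `decide`d on `ℤ/21`, no named fact, no `sorry`.  §8: Yanai's bound gives
`Rank(Φ₂₁) ≤ 6` (`cmTypeRank_Φ₂₁_le`) and six unitriangular translates give `Rank(Φ₂₁) = 6` exactly
(`cmTypeRank_Φ₂₁`: the index of degeneracy is `1`, Yanai's bound is attained).  NOT here: algebraicity of
the Weil classes of these sixfolds (open in print for this CM point, to the typist's knowledge: Schoen / van Geemen
4.15–4.16 treat general Weil-type fourfolds and sixfolds with `K = ℚ(√-3)` under a discriminant condition).

## Sources (held texts read this session)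

* B. B. Gordon, *A survey of the Hodge conjecture for abelian varieties* [Gordon1999HodgeAVSurvey]
  (`paper:arxiv-alg-geom_9709030`): 5.13 (ii) (p0017–p0018: Weil-type CM fourfolds, `dim Hdg² = 8 > 6 = dim Div²`);
  9.4 (p0025 L45–50: nondegenerate / degenerate); 9.4.2 (p0025 L63–L100: Ribet's and Lenstra's degenerate types in
  `ℚ(ζ_p)`, `ℚ(ζ₃₂)`, `ℚ(ζ₁₉)`, "verified … by exhibiting odd characters `χ` such that `Σ_{s∈S} χ(s) = 0`");
  9.4.3 Theorem [B.140] (p0026 L49–72, Yanai: "if … `a = b` then the CM-type `(K,S)` is degenerate").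
* H. Pohlmann, Ann. of Math. 88 (1968) [Pohlmann1968], Thm. 1 (tree theorem `Pohlmann1968_thm1_holds`) and §3.
* B. van Geemen, LNM 1594 (1994) [vanGeemen1994HodgeAV], Thm. 4.5, 4.7.
* G. Shimura, *Abelian Varieties with Complex Multiplication and Modular Functions* (1998) [Shimura1998], §6.2
  Thm. 3 (existence record), §8.2 Prop. 26 (primitive ⟺ simple; tree theorem of `PrimitiveCMTypeSimple`).
-/

noncomputable section

open CategoryTheory NumberField Polynomial

namespace Literature.AlgebraicGeometry.Pohlmann1968

namespace Cyclotomic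

/-! ### §1 `Aut(ℂ)` on the `n`-th roots of unity (generic `n`) -/

section Root

variable (n : ℕ) [NeZero n]

/-- The chosen primitive `n`-th root of unity `ζₙ = e^{2πi/n} ∈ ℂ`. [folklore] -/
def rootζ : ℂ := Complex.exp (2 * Real.pi * Complex.I / n)

/-- `ζₙ` is a primitive `n`-th root of unity. [cite: Washington1997, Thm. 2.5] -/
private theorem isPrimitiveRoot_rootζ : IsPrimitiveRoot (rootζ n) n := by
  simpa [rootζ] using Complex.isPrimitiveRoot_exp n (NeZero.ne n)

/-- `ζₙⁿ = 1`. [folklore] -/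
private theorem rootζ_pow : rootζ n ^ n = 1 := (isPrimitiveRoot_rootζ n).pow_eq_one

/-- Exponents are read off injectively: `ζₙ^a = ζₙ^b ↔ a = b` in `ℤ/n`. [folklore] -/
private theorem rootζ_pow_inj {a b : ZMod n} (h : rootζ n ^ a.val = rootζ n ^ b.val) : a = b :=
  ZMod.val_injective n ((isPrimitiveRoot_rootζ n).pow_inj (ZMod.val_lt a) (ZMod.val_lt b) h)

/-- Every automorphism of `ℂ` raises `ζₙ` to a power prime to `n`. [folklore] -/
private theorem exists_ringEquiv_apply_rootζ (τ : ℂ ≃+* ℂ) : ∃ i < n, i.Coprime n ∧ rootζ n ^ i = τ (rootζ n) := by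
  have hτ : IsPrimitiveRoot (τ (rootζ n)) n := (isPrimitiveRoot_rootζ n).map_of_injective τ.injective
  exact ((isPrimitiveRoot_rootζ n).isPrimitiveRoot_iff).1 hτ

/-- The exponent `u(τ) ∈ ℤ/n` of an automorphism `τ` of `ℂ` on the `n`-th roots of unity (the cyclotomic character):
`τ ζₙ = ζₙ^{u(τ)}`. [folklore] -/
def autExp (τ : ℂ ≃+* ℂ) : ZMod n := ((Classical.choose (exists_ringEquiv_apply_rootζ n τ) : ℕ) : ZMod n)

/-- Defining property of the exponent: `τ ζₙ = ζₙ^{u(τ)}`. [cite: Washington1997, Thm. 2.5] -/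
theorem autExp_spec (τ : ℂ ≃+* ℂ) : τ (rootζ n) = rootζ n ^ (autExp n τ).val := by
  obtain ⟨hi, -, h⟩ := Classical.choose_spec (exists_ringEquiv_apply_rootζ n τ)
  rw [autExp, ZMod.val_natCast, Nat.mod_eq_of_lt hi, h]

/-- The exponent `u(τ)` is prime to `n`. [cite: Washington1997, Thm. 2.5] -/
theorem coprime_autExp (τ : ℂ ≃+* ℂ) : (autExp n τ).val.Coprime n := by
  obtain ⟨hi, hc, -⟩ := Classical.choose_spec (exists_ringEquiv_apply_rootζ n τ)
  rw [autExp, ZMod.val_natCast, Nat.mod_eq_of_lt hi]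
  exact hc

/-- `τ (ζₙ^c) = ζₙ^{u(τ) c}` for every exponent `c ∈ ℤ/n`. [folklore] -/
private theorem ringEquiv_apply_rootζ_pow (τ : ℂ ≃+* ℂ) (c : ZMod n) :
    τ (rootζ n ^ c.val) = rootζ n ^ (autExp n τ * c).val := by
  rw [map_pow, autExp_spec, ← pow_mul, ZMod.val_mul, ← pow_eq_pow_mod _ (rootζ_pow n)]

/-- Complex conjugation has exponent `-1`. [folklore] -/
private theorem autExp_conj : autExp n (starRingAut : ℂ ≃+* ℂ) = -1 := by
  apply rootζ_pow_inj n
  rw [← autExp_spec]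
  have h1 : ‖rootζ n‖ = 1 := Complex.norm_eq_one_of_pow_eq_one (rootζ_pow n) (NeZero.ne n)
  have hinv : rootζ n ^ (-1 : ZMod n).val = (rootζ n)⁻¹ := by
    apply eq_inv_of_mul_eq_one_left
    rw [← pow_succ]
    have : ((-1 : ZMod n).val + 1) % n = 0 := by
      have h := ZMod.val_add (-1 : ZMod n) 1
      rw [neg_add_cancel, ZMod.val_zero] at h
      rcases Nat.eq_zero_or_pos n with hn | hn
      · exact absurd hn (NeZero.ne n)
      · have h1' : (1 : ZMod n).val = 1 % n := ZMod.val_one_eq_one_mod n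
        rw [h1', Nat.add_mod, Nat.mod_mod, ← Nat.add_mod] at h
        exact h.symm
    rw [pow_eq_pow_mod _ (rootζ_pow n), this, pow_zero]
  rw [hinv, Complex.inv_eq_conj h1]
  rfl

/-- Every exponent prime to `n` is realised by an automorphism of `ℂ` (the primitive `n`-th roots of unity are
conjugate over `ℚ`). [cite: Washington1997, Thm. 2.5] -/
theorem exists_autExp_eq (u : ZMod n) (hu : u.val.Coprime n) : ∃ τ : ℂ ≃+* ℂ, autExp n τ = u := by
  have hpos : 0 < n := Nat.pos_of_ne_zero (NeZero.ne n)
  have hint : IsIntegral ℚ (rootζ n) := ((isPrimitiveRoot_rootζ n).isIntegral hpos).tower_top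
  have hroot : aeval (rootζ n ^ u.val) (minpoly ℚ (rootζ n)) = 0 := by
    rw [← cyclotomic_eq_minpoly_rat (isPrimitiveRoot_rootζ n) hpos, aeval_def, ← Polynomial.eval_map,
      map_cyclotomic, ← IsRoot.def, isRoot_cyclotomic_iff]
    exact (isPrimitiveRoot_rootζ n).pow_of_coprime u.val hu
  obtain ⟨τ, hτ⟩ :=
    Literature.FieldTheory.AlgClosed.Complex.exists_ringEquiv_apply_eq_of_aeval_minpoly_eq_zero hint hroot
  exact ⟨τ, rootζ_pow_inj n (by rw [← autExp_spec, hτ])⟩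

end Root

/-! ### §2 Exponents of complex embeddings on an `n`-th root of unity (generic `n`) -/

section Emb

variable (n : ℕ) [NeZero n] {L : Type} [Field L] {x : L}

/-- For `x ∈ L` with `xⁿ = 1`, every embedding `σ : L → ℂ` sends `x` to a power of `ζₙ`. [folklore] -/
private theorem exists_apply_eq_rootζ_pow (hx : x ^ n = 1) (σ : L →+* ℂ) : ∃ i < n, rootζ n ^ i = σ x :=
  (isPrimitiveRoot_rootζ n).eq_pow_of_pow_eq_one (by rw [← map_pow, hx, map_one])

/-- The exponent `e(σ) ∈ ℤ/n` of an embedding on an `n`-th root of unity `x`: `σ x = ζₙ^{e(σ)}`. [folklore] -/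
def embExp (hx : x ^ n = 1) (σ : L →+* ℂ) : ZMod n :=
  ((Classical.choose (exists_apply_eq_rootζ_pow n hx σ) : ℕ) : ZMod n)

/-- Defining property: `σ x = ζₙ^{e(σ)}`. [cite: Washington1997, Thm. 2.5] -/
theorem embExp_spec (hx : x ^ n = 1) (σ : L →+* ℂ) : σ x = rootζ n ^ (embExp n hx σ).val := by
  obtain ⟨hi, h⟩ := Classical.choose_spec (exists_apply_eq_rootζ_pow n hx σ)
  rw [embExp, ZMod.val_natCast, Nat.mod_eq_of_lt hi, h]

/-- The exponent is determined by `σ x`. [cite: Washington1997, Thm. 2.5] -/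
theorem embExp_eq_of_apply_eq (hx : x ^ n = 1) {σ : L →+* ℂ} {c : ZMod n} (h : σ x = rootζ n ^ c.val) :
    embExp n hx σ = c :=
  rootζ_pow_inj n (by rw [← embExp_spec, h])

/-- **Equivariance**: `e(τ ∘ σ) = u(τ) · e(σ)` — `Aut(ℂ)` acts on the exponents through the cyclotomic character.
[cite: Washington1997, Thm. 2.5] -/
theorem embExp_comp (hx : x ^ n = 1) (τ : ℂ ≃+* ℂ) (σ : L →+* ℂ) :
    embExp n hx ((τ : ℂ →+* ℂ).comp σ) = autExp n τ * embExp n hx σ :=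
  embExp_eq_of_apply_eq n hx (by rw [RingHom.comp_apply, embExp_spec n hx σ]; exact ringEquiv_apply_rootζ_pow n τ _)

/-- Complex conjugation negates the exponent. [cite: Washington1997, Thm. 2.5] -/
theorem embExp_conjugate (hx : x ^ n = 1) (σ : L →+* ℂ) :
    embExp n hx (ComplexEmbedding.conjugate σ) = -embExp n hx σ := by
  have h : ComplexEmbedding.conjugate σ = ((starRingAut : ℂ ≃+* ℂ) : ℂ →+* ℂ).comp σ := rfl
  rw [h, embExp_comp, autExp_conj, neg_one_mul]

/-- On a power `x^a` the exponent gets multiplied: `e_{x^a}(σ) = a · e_x(σ)` (for `(x^a)^n = 1`). [cite: Washington1997, Thm. 2.5] -/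
theorem embExp_pow (hx : x ^ n = 1) (a : ℕ) (hxa : (x ^ a) ^ n = 1) (σ : L →+* ℂ) :
    embExp n hxa σ = (a : ZMod n) * embExp n hx σ := by
  apply embExp_eq_of_apply_eq n hxa
  rw [map_pow, embExp_spec n hx σ, ← pow_mul, ZMod.val_mul, ZMod.val_natCast,
    pow_eq_pow_mod ((embExp n hx σ).val * a) (rootζ_pow n)]
  congr 1
  have h : a % n * (embExp n hx σ).val ≡ a * (embExp n hx σ).val [MOD n] := (Nat.mod_modEq a n).mul_right _
  rw [mul_comm]
  exact h.symm

end Emb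

/-! ### §3 The field `L = ℚ(ζ₂₁)`: embeddings and the CM type `Φ₂₁` -/

section TwentyOne

variable (L : Type) [Field L] [NumberField L] [IsCyclotomicExtension {21} ℚ L]

/-- The generator `ζ₂₁ ∈ L = ℚ(ζ₂₁)` (Mathlib's `IsCyclotomicExtension.zeta`). [folklore] -/
abbrev z : L := IsCyclotomicExtension.zeta 21 ℚ L

/-- `ζ₂₁` is a primitive 21st root of unity. [folklore] -/
private theorem z_spec : IsPrimitiveRoot (z L) 21 := IsCyclotomicExtension.zeta_spec 21 ℚ L

/-- `ζ₂₁²¹ = 1`. [folklore] -/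
private theorem z_pow : z L ^ 21 = 1 := (z_spec L).pow_eq_one

/-- The exponent `e(σ) ∈ ℤ/21` of an embedding `σ` of `ℚ(ζ₂₁)`: `σ ζ₂₁ = e^{2πi e(σ)/21}`. [folklore] -/
def exp₂₁ (σ : L →+* ℂ) : ZMod 21 := embExp 21 (z_pow L) σ

/-- `σ ζ₂₁ = ζ^{e(σ)}`. [cite: Washington1997, Thm. 2.5] -/
theorem exp₂₁_spec (σ : L →+* ℂ) : σ (z L) = rootζ 21 ^ (exp₂₁ L σ).val := embExp_spec 21 (z_pow L) σ

/-- The exponent of an embedding of `ℚ(ζ₂₁)` is determined by the image of `ζ₂₁`. [cite: Washington1997, Thm. 2.5] -/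
theorem exp₂₁_eq_of_apply_eq {σ : L →+* ℂ} {c : ZMod 21} (h : σ (z L) = rootζ 21 ^ c.val) : exp₂₁ L σ = c :=
  embExp_eq_of_apply_eq 21 (z_pow L) h

/-- `e(τ ∘ σ) = u(τ) e(σ)`. [cite: Washington1997, Thm. 2.5] -/
theorem exp₂₁_comp (τ : ℂ ≃+* ℂ) (σ : L →+* ℂ) : exp₂₁ L ((τ : ℂ →+* ℂ).comp σ) = autExp 21 τ * exp₂₁ L σ :=
  embExp_comp 21 (z_pow L) τ σ

/-- `e(σ̄) = -e(σ)`. [cite: Washington1997, Thm. 2.5] -/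
theorem exp₂₁_conjugate (σ : L →+* ℂ) : exp₂₁ L (ComplexEmbedding.conjugate σ) = -exp₂₁ L σ :=
  embExp_conjugate 21 (z_pow L) σ

/-- The 21st cyclotomic polynomial is irreducible over `ℚ`. [folklore] -/
private theorem irreducible_cyclotomic_21 : Irreducible (cyclotomic 21 ℚ) :=
  cyclotomic.irreducible_rat (by norm_num)

/-- Embeddings of `ℚ(ζ₂₁)` are determined by their exponent. [cite: Washington1997, Thm. 2.5] -/
theorem exp₂₁_injective : Function.Injective (exp₂₁ L) := by
  intro σ σ' h
  have hz : σ (z L) = σ' (z L) := by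
    rw [exp₂₁_spec L σ, exp₂₁_spec L σ']
    exact congrArg (fun c : ZMod 21 => rootζ 21 ^ c.val) h
  have := ((z_spec L).embeddingsEquivPrimitiveRoots ℂ irreducible_cyclotomic_21).injective
    (a₁ := σ.toRatAlgHom) (a₂ := σ'.toRatAlgHom)
    (Subtype.ext (by simpa [RingHom.toRatAlgHom_apply] using hz))
  rw [← RingHom.toRatAlgHom_toRingHom σ, ← RingHom.toRatAlgHom_toRingHom σ', this]

/-- The exponent of an embedding of `ℚ(ζ₂₁)` is prime to `21`. [cite: Washington1997, Thm. 2.5] -/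
theorem coprime_exp₂₁ (σ : L →+* ℂ) : (exp₂₁ L σ).val.Coprime 21 := by
  have hprim : IsPrimitiveRoot (σ (z L)) 21 := (z_spec L).map_of_injective σ.injective
  rw [exp₂₁_spec L σ] at hprim
  exact ((isPrimitiveRoot_rootζ 21).pow_iff_coprime (by norm_num) _).1 hprim

/-- Every exponent prime to `21` is the exponent of some embedding of `ℚ(ζ₂₁)`. [cite: Washington1997, Thm. 2.5] -/
theorem exists_exp₂₁_eq (c : ZMod 21) (hc : c.val.Coprime 21) : ∃ σ : L →+* ℂ, exp₂₁ L σ = c := by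
  have hmem : rootζ 21 ^ c.val ∈ primitiveRoots 21 ℂ :=
    (mem_primitiveRoots (by norm_num)).2 ((isPrimitiveRoot_rootζ 21).pow_of_coprime c.val hc)
  let φ : L →ₐ[ℚ] ℂ := ((z_spec L).embeddingsEquivPrimitiveRoots ℂ irreducible_cyclotomic_21).symm ⟨_, hmem⟩
  refine ⟨φ.toRingHom, exp₂₁_eq_of_apply_eq L ?_⟩
  have h := (z_spec L).embeddingsEquivPrimitiveRoots_apply_coe ℂ irreducible_cyclotomic_21 φ
  simp only [φ, Equiv.apply_symm_apply] at h
  exact h.symm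

/-- `[ℚ(ζ₂₁) : ℚ] = φ(21) = 12`. [cite: Washington1997, Thm. 2.5] -/
theorem finrank_eq : Module.finrank ℚ L = 12 := by
  rw [IsCyclotomicExtension.finrank (n := 21) L irreducible_cyclotomic_21]; decide

/-- `ℚ(ζ₂₁)` is a CM field (Mathlib: nontrivial cyclotomic fields are CM). [folklore] -/
private theorem isCMField : IsCMField L := IsCyclotomicExtension.Rat.isCMField L (S := {21}) ⟨21, rfl, by norm_num⟩

/-- The units of `ℤ/21`, as a finite set of residues (the possible exponents of embeddings). [folklore] -/
def units21 : Finset (ZMod 21) := {1, 2, 4, 5, 8, 10, 11, 13, 16, 17, 19, 20}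

/-- `c` is prime to `21` iff `c ∈ units21`. [folklore] -/
private theorem coprime_iff_mem_units21 (c : ZMod 21) : c.val.Coprime 21 ↔ c ∈ units21 := by
  revert c; decide

/-- **The set of exponents `S = {1, 2, 4, 5, 8, 10} ⊂ (ℤ/21)ˣ` of the CM type `Φ₂₁`**: a set of representatives of
`(ℤ/21)ˣ/{±1}`; no unit `u ≠ 1` stabilises it (primitivity); it meets each fibre of `(ℤ/21)ˣ → (ℤ/3)ˣ` in exactly
half (`{1,4,10}`, `{2,5,8}`: balanced over `ℚ(ζ₃) = ℚ(√-3)` with multiplicities `(3,3)`). [folklore] -/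
def S₂₁ : Finset (ZMod 21) := {1, 2, 4, 5, 8, 10}

open Literature.AlgebraicGeometry.Motives (CMType)

/-- **The CM type `Φ₂₁ = {σ_a | a ∈ {1,2,4,5,8,10}}` of `ℚ(ζ₂₁)`** (`σ_a : ζ₂₁ ↦ e^{2πia/21}`). [folklore] -/
def Φ₂₁ : CMType L :=
  ⟨{σ | exp₂₁ L σ ∈ S₂₁}, fun σ => by
    simp only [Set.mem_setOf_eq]
    rw [exp₂₁_conjugate]
    have key : ∀ c : ZMod 21, c.val.Coprime 21 → (c ∈ S₂₁ ↔ -c ∉ S₂₁) := by decide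
    exact key _ (coprime_exp₂₁ L σ)⟩

/-- Membership in `Φ₂₁` is read on the exponent. [folklore] -/
private theorem mem_Φ₂₁_iff (σ : L →+* ℂ) : σ ∈ (Φ₂₁ L).1 ↔ exp₂₁ L σ ∈ S₂₁ := Iff.rfl

/-! ### §4 `Φ₂₁` is primitive -/

/-- The combinatorial heart of primitivity: the translates `u · S`, `u ∈ (ℤ/21)ˣ`, separate the units. [folklore] -/
private theorem separating_S₂₁ : ∀ a ∈ units21, ∀ b ∈ units21,
    (∀ u ∈ units21, (u * a ∈ S₂₁ ↔ u * b ∈ S₂₁)) → a = b := by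
  decide

/-- **The Galois translates of `Φ₂₁` separate the embeddings of `ℚ(ζ₂₁)`** (for every unit `u` there is an
automorphism of `ℂ` with cyclotomic character `u`). [folklore] -/
private theorem separating_Φ₂₁ (s s' : L →+* ℂ)
    (h : ∀ τ : ℂ ≃+* ℂ, (τ : ℂ →+* ℂ).comp s ∈ (Φ₂₁ L).1 ↔ (τ : ℂ →+* ℂ).comp s' ∈ (Φ₂₁ L).1) : s = s' := by
  apply exp₂₁_injective L
  refine separating_S₂₁ _ ((coprime_iff_mem_units21 _).1 (coprime_exp₂₁ L s)) _
    ((coprime_iff_mem_units21 _).1 (coprime_exp₂₁ L s')) fun u hu => ?_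
  obtain ⟨τ, hτ⟩ := exists_autExp_eq 21 u ((coprime_iff_mem_units21 u).2 hu)
  have h1 := h τ
  rw [mem_Φ₂₁_iff, mem_Φ₂₁_iff, exp₂₁_comp, exp₂₁_comp, hτ] at h1
  exact h1

open Literature.NumberTheory.ComplexMultiplication in
/-- **`Φ₂₁` is a PRIMITIVE CM type** (Shimura §8.2 Prop. 26 form `IsPrimitive`, at every base embedding): so the
abelian varieties of type `(ℚ(ζ₂₁); Φ₂₁)` are simple. [cite: Shimura1998, §8.2 Prop. 26] -/
theorem isPrimitive_Φ₂₁ (φ₀ : L →+* ℂ) : IsPrimitive (ℂ ≃+* ℂ) (Φ₂₁ L).1 φ₀ := by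
  haveI := isPretransitive_ringEquiv_complex (K := L)
  exact (isPrimitive_iff_forall_eq (Φ₂₁ L).1 φ₀).2 fun s s' hs => separating_Φ₂₁ L s s' hs

/-- Counting embeddings of `ℚ(ζ₂₁)` through their exponents: `#{σ | Q(e(σ))} = #{c ∈ (ℤ/21)ˣ | Q(c)}`
(`σ ↦ e(σ)` is a bijection onto the units). [folklore] -/
private theorem ncard_setOf_exp₂₁ (Q : ZMod 21 → Prop) [DecidablePred Q] :
    {σ : L →+* ℂ | Q (exp₂₁ L σ)}.ncard = (units21.filter Q).card := by
  rw [← Set.ncard_image_of_injective {σ : L →+* ℂ | Q (exp₂₁ L σ)} (exp₂₁_injective L),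
    ← Set.ncard_coe_finset]
  congr 1
  ext c
  simp only [Set.mem_image, Set.mem_setOf_eq, Finset.coe_filter]
  constructor
  · rintro ⟨σ, hσ, rfl⟩
    exact ⟨(coprime_iff_mem_units21 _).1 (coprime_exp₂₁ L σ), hσ⟩
  · rintro ⟨hc, hQ⟩
    obtain ⟨σ, rfl⟩ := exists_exp₂₁_eq L c ((coprime_iff_mem_units21 c).2 hc)
    exact ⟨σ, hQ, rfl⟩

end TwentyOne

/-! ### §5 The subfield `ℚ(ζ₃) = ℚ(√-3) ⊂ ℚ(ζ₂₁)` and the fibres of the restriction of embeddings -/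

section Three

variable (k : Type) [Field k] [NumberField k] [IsCyclotomicExtension {3} ℚ k]
variable (L : Type) [Field L] [NumberField L] [IsCyclotomicExtension {21} ℚ L]

/-- The generator `ζ₃ ∈ k = ℚ(ζ₃)`. [folklore] -/
abbrev z₃ : k := IsCyclotomicExtension.zeta 3 ℚ k

/-- `ζ₃` is a primitive cube root of unity. [folklore] -/
private theorem z₃_spec : IsPrimitiveRoot (z₃ k) 3 := IsCyclotomicExtension.zeta_spec 3 ℚ k

/-- `ζ₃³ = 1`. [folklore] -/
private theorem z₃_pow : z₃ k ^ 3 = 1 := (z₃_spec k).pow_eq_one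

/-- The exponent `e₃(τ) ∈ ℤ/3` of an embedding `τ` of `ℚ(ζ₃)`: `τ ζ₃ = e^{2πi e₃(τ)/3}`. [folklore] -/
def exp₃ (τ : k →+* ℂ) : ZMod 3 := embExp 3 (z₃_pow k) τ

/-- The third cyclotomic polynomial is irreducible over `ℚ`. [folklore] -/
private theorem irreducible_cyclotomic_3 : Irreducible (cyclotomic 3 ℚ) := cyclotomic.irreducible_rat (by norm_num)

/-- Embeddings of `ℚ(ζ₃)` are determined by their exponent. [folklore] -/
private theorem exp₃_injective : Function.Injective (exp₃ k) := by
  intro σ σ' h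
  have hz : σ (z₃ k) = σ' (z₃ k) := by
    rw [show σ (z₃ k) = rootζ 3 ^ (exp₃ k σ).val from embExp_spec 3 (z₃_pow k) σ,
      show σ' (z₃ k) = rootζ 3 ^ (exp₃ k σ').val from embExp_spec 3 (z₃_pow k) σ', h]
  have := ((z₃_spec k).embeddingsEquivPrimitiveRoots ℂ irreducible_cyclotomic_3).injective
    (a₁ := σ.toRatAlgHom) (a₂ := σ'.toRatAlgHom)
    (Subtype.ext (by simpa [RingHom.toRatAlgHom_apply] using hz))
  rw [← RingHom.toRatAlgHom_toRingHom σ, ← RingHom.toRatAlgHom_toRingHom σ', this]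

/-- The exponent of an embedding of `ℚ(ζ₃)` is prime to `3`. [folklore] -/
private theorem coprime_exp₃ (τ : k →+* ℂ) : (exp₃ k τ).val.Coprime 3 := by
  have hprim : IsPrimitiveRoot (τ (z₃ k)) 3 := (z₃_spec k).map_of_injective τ.injective
  rw [show τ (z₃ k) = rootζ 3 ^ (exp₃ k τ).val from embExp_spec 3 (z₃_pow k) τ] at hprim
  exact ((isPrimitiveRoot_rootζ 3).pow_iff_coprime (by norm_num) _).1 hprim

/-- No embedding of `ℚ(ζ₃)` is real: `τ̄ ≠ τ` (`e₃(τ̄) = -e₃(τ) ≠ e₃(τ)` in `(ℤ/3)ˣ`). [folklore] -/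
private theorem conjugate_ne (τ : k →+* ℂ) : ComplexEmbedding.conjugate τ ≠ τ := by
  intro h
  have h1 := congrArg (exp₃ k) h
  rw [exp₃, embExp_conjugate] at h1
  have key : ∀ t : ZMod 3, t.val.Coprime 3 → -t ≠ t := by decide
  exact key _ (coprime_exp₃ k τ) h1

/-- `ζ₂₁⁷` is a primitive cube root of unity in `ℚ(ζ₂₁)`. [folklore] -/
private theorem z_pow_seven_spec : IsPrimitiveRoot (z L ^ 7) 3 := (z_spec L).pow (by norm_num) (by norm_num)

/-- `ζ₂₁⁷` is a root of the minimal polynomial of `ζ₃` (both are primitive cube roots of unity; the minimal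
polynomial is the third cyclotomic polynomial). [folklore] -/
private theorem aeval_z_pow_seven_minpoly :
    aeval (z L ^ 7) (minpoly ℚ ((z₃_spec k).powerBasis ℚ).gen) = 0 := by
  rw [IsPrimitiveRoot.powerBasis_gen, ← cyclotomic_eq_minpoly_rat (z₃_spec k) (by norm_num), aeval_def,
    ← Polynomial.eval_map, map_cyclotomic, ← IsRoot.def, isRoot_cyclotomic_iff]
  exact z_pow_seven_spec L

/-- **The inclusion `ℚ(ζ₃) ↪ ℚ(ζ₂₁)`, `ζ₃ ↦ ζ₂₁⁷`.** [folklore] -/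
def j₃ : k →+* L := (((z₃_spec k).powerBasis ℚ).lift (z L ^ 7) (aeval_z_pow_seven_minpoly k L)).toRingHom

/-- `j₃ ζ₃ = ζ₂₁⁷`. [folklore] -/
private theorem j₃_z₃ : j₃ k L (z₃ k) = z L ^ 7 := by
  have h := ((z₃_spec k).powerBasis ℚ).lift_gen (z L ^ 7) (aeval_z_pow_seven_minpoly k L)
  rw [IsPrimitiveRoot.powerBasis_gen] at h
  exact h

/-- `e^{2πi/3} = (e^{2πi/21})⁷`. [folklore] -/
private theorem rootζ_three_eq : rootζ 3 = rootζ 21 ^ 7 := by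
  rw [rootζ, rootζ, ← Complex.exp_nat_mul]
  congr 1
  push_cast
  ring

/-- Reduction of exponents modulo `3`: `(ℤ/21) → ℤ/3`. [folklore] -/
def red3 (c : ZMod 21) : ZMod 3 := (c.val : ZMod 3)

/-- **Restriction to `ℚ(ζ₃)` reduces the exponent modulo `3`**: `e₃(σ|_{ℚ(ζ₃)}) = e(σ) mod 3`. [folklore] -/
private theorem exp₃_comp_j₃ (σ : L →+* ℂ) : exp₃ k (σ.comp (j₃ k L)) = red3 (exp₂₁ L σ) := by
  apply embExp_eq_of_apply_eq 3 (z₃_pow k)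
  rw [RingHom.comp_apply, j₃_z₃, map_pow, exp₂₁_spec, ← pow_mul, rootζ_three_eq, ← pow_mul, red3,
    ZMod.val_natCast, pow_eq_pow_mod ((exp₂₁ L σ).val * 7) (rootζ_pow 21),
    pow_eq_pow_mod (7 * ((exp₂₁ L σ).val % 3)) (rootζ_pow 21)]
  congr 1
  have key : ∀ e : ℕ, e < 21 → e * 7 % 21 = 7 * (e % 3) % 21 := by decide
  exact key _ (ZMod.val_lt _)

/-- The fibre condition `σ|_{ℚ(ζ₃)} = τ` read on exponents: `e(σ) ≡ e₃(τ) (mod 3)`. [folklore] -/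
private theorem comp_j₃_eq_iff (σ : L →+* ℂ) (τ : k →+* ℂ) : σ.comp (j₃ k L) = τ ↔ red3 (exp₂₁ L σ) = exp₃ k τ := by
  rw [← exp₃_comp_j₃ k L σ]
  exact ⟨fun h => h ▸ rfl, fun h => exp₃_injective k h⟩

open Literature.AlgebraicGeometry.Motives (CMType)

/-- **`Φ₂₁` is balanced over `ℚ(ζ₃)`** (Weil type, multiplicities `(3,3)`): over each embedding `τ` of `ℚ(ζ₃)`, three
of the six extensions of `τ` to `ℚ(ζ₂₁)` lie in `Φ₂₁` (`{1,4,10}` resp. `{2,5,8}` modulo `21`) and three outside.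
[cite: vanGeemen1994HodgeAV, 4.7 and Def. 4.9] -/
theorem fibres_balanced_Φ₂₁ (τ : k →+* ℂ) :
    {φ : L →+* ℂ | φ.comp (j₃ k L) = τ ∧ φ ∈ (Φ₂₁ L).1}.ncard =
      {φ : L →+* ℂ | φ.comp (j₃ k L) = τ ∧ φ ∉ (Φ₂₁ L).1}.ncard := by
  have h1 : {φ : L →+* ℂ | φ.comp (j₃ k L) = τ ∧ φ ∈ (Φ₂₁ L).1} =
      {φ : L →+* ℂ | red3 (exp₂₁ L φ) = exp₃ k τ ∧ exp₂₁ L φ ∈ S₂₁} := by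
    ext φ; simp only [Set.mem_setOf_eq, comp_j₃_eq_iff, mem_Φ₂₁_iff]
  have h2 : {φ : L →+* ℂ | φ.comp (j₃ k L) = τ ∧ φ ∉ (Φ₂₁ L).1} =
      {φ : L →+* ℂ | red3 (exp₂₁ L φ) = exp₃ k τ ∧ exp₂₁ L φ ∉ S₂₁} := by
    ext φ; simp only [Set.mem_setOf_eq, comp_j₃_eq_iff, mem_Φ₂₁_iff]
  rw [h1, h2, ncard_setOf_exp₂₁ L (fun c => red3 c = exp₃ k τ ∧ c ∈ S₂₁),
    ncard_setOf_exp₂₁ L (fun c => red3 c = exp₃ k τ ∧ c ∉ S₂₁)]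
  have key : ∀ t : ZMod 3, t.val.Coprime 3 →
      (units21.filter fun c => red3 c = t ∧ c ∈ S₂₁).card = (units21.filter fun c => red3 c = t ∧ c ∉ S₂₁).card := by
    decide
  exact key _ (coprime_exp₃ k τ)

open scoped Classical in
/-- Each fibre of the restriction `Hom(ℚ(ζ₂₁), ℂ) → Hom(ℚ(ζ₃), ℂ)` has `6 = [ℚ(ζ₂₁) : ℚ(ζ₃)]` elements. [cite: MilneFT2022, Prop. 2.7 (a)] -/
theorem card_fibre_Φ₂₁ (τ : k →+* ℂ) :
    (Finset.univ.filter fun φ : L →+* ℂ => φ.comp (j₃ k L) = τ).card = 6 := by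
  have h1 : (Finset.univ.filter fun φ : L →+* ℂ => φ.comp (j₃ k L) = τ).card =
      {φ : L →+* ℂ | red3 (exp₂₁ L φ) = exp₃ k τ}.ncard := by
    rw [← Set.ncard_coe_finset]; congr 1; ext φ
    simp only [Finset.coe_filter, Finset.mem_univ, true_and, Set.mem_setOf_eq, comp_j₃_eq_iff]
  rw [h1, ncard_setOf_exp₂₁ L (fun c => red3 c = exp₃ k τ)]
  have key : ∀ t : ZMod 3, t.val.Coprime 3 → (units21.filter fun c => red3 c = t).card = 6 := by decide
  exact key _ (coprime_exp₃ k τ)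

end Three

/-! ### §6 Consequences: `Φ₂₁` is degenerate, and its realisations carry exceptional Hodge classes in degree `6` -/

section Consequences

variable (L : Type) [Field L] [NumberField L] [IsCyclotomicExtension {21} ℚ L]

open Literature.AlgebraicGeometry.Motives (AbelianVariety CMType)
open Literature.AlgebraicGeometry.HodgeTheory
open Literature.AlgebraicGeometry.ComplexMultiplication (IsCMTypeRealisation)
open Literature.Barriers.HodgeConjecture (divisorClassesSpan)

/-- `ℚ(ζ₃)` realised as Mathlib's `CyclotomicField 3 ℚ` is a `{3}`-cyclotomic extension of `ℚ` (Mathlib's instance,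
named here because instance search does not find it through the `NeZero` side condition). [folklore] -/
private theorem isCyclotomicExtension_cyclotomicField_three : IsCyclotomicExtension {3} ℚ (CyclotomicField 3 ℚ) :=
  CyclotomicField.isCyclotomicExtension 3 ℚ

/-- `ℚ(ζ₃)` realised as Mathlib's `CyclotomicField 3 ℚ` is a number field. [folklore] -/
private theorem numberField_cyclotomicField_three : NumberField (CyclotomicField 3 ℚ) :=
  haveI := isCyclotomicExtension_cyclotomicField_three
  IsCyclotomicExtension.numberField {3} ℚ _

/-- **`Φ₂₁` is a DEGENERATE CM type** (`Rank(Φ₂₁) ≤ 6 = n`; Yanai's theorem for the subfield `ℚ(√-3)`, over which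
`Φ₂₁` is balanced) — although it is primitive (`isPrimitive_Φ₂₁`): Kubota's implication "nondegenerate ⟹ primitive"
is not reversible, already for the abelian CM field `ℚ(ζ₂₁)` of degree `12`.
[cite: Gordon1999HodgeAVSurvey, §9.4.3 (Theorem [B.140], Yanai 1994) and 9.4.2] -/
theorem not_isNondegenerate_Φ₂₁ : ¬IsNondegenerate (Φ₂₁ L) := by
  haveI := isCyclotomicExtension_cyclotomicField_three
  haveI := numberField_cyclotomicField_three
  haveI := isCMField L
  obtain ⟨τ₀, -⟩ := exists_exp₂₁_eq L 1 (by decide)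
  exact not_isNondegenerate_of_fibres_balanced (j₃ (CyclotomicField 3 ℚ) L)
    (fibres_balanced_Φ₂₁ (CyclotomicField 3 ℚ) L)
    (conjugate_ne (CyclotomicField 3 ℚ) (τ₀.comp (j₃ (CyclotomicField 3 ℚ) L)))

variable {L} {A : AbelianVariety ℂ} {ι : 𝓞 L →+* End A} {θ : L →+* Module.End ℂ (complexBetti A.X 1)}

/-- **Every realisation of `(ℚ(ζ₂₁); Φ₂₁)` — a CM abelian SIXFOLD of a PRIMITIVE type — carries a rational
`(3,3)`-class outside `D³ ⊗ ℂ`** (the Weil classes of `(A, ℚ(√-3))`): the Mumford–Pohlmann mechanism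
`exists_exceptional_of_fibres_balanced` for the subfield `ℚ(ζ₃) ⊂ ℚ(ζ₂₁)`, fibre size `6`.
[cite: Gordon1999HodgeAVSurvey, 5.13 (ii) and 9.2.2] [cite: Pohlmann1968, Thm. 1 and §3] -/
theorem exists_exceptional_Φ₂₁ (hA : IsCMTypeRealisation (Φ₂₁ L) A ι θ) :
    ∃ c : complexBetti A.X (2 * 3), IsRationalClass c ∧ IsOfHodgeType 6 A.X (2 * 3) 3 3 c ∧
      c ∉ divisorClassesSpan A.X 6 3 := by
  haveI := isCyclotomicExtension_cyclotomicField_three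
  haveI := numberField_cyclotomicField_three
  haveI := isCMField L
  obtain ⟨τ₀, -⟩ := exists_exp₂₁_eq L 1 (by decide)
  set k := CyclotomicField 3 ℚ
  obtain ⟨m, hm, c, hcQ, hcH, hcD⟩ := exists_exceptional_of_fibres_balanced' (j₃ k L)
    τ₀ (isPrimitive_Φ₂₁ L τ₀) (fibres_balanced_Φ₂₁ k L) (conjugate_ne k (τ₀.comp (j₃ k L))) hA
  rw [card_fibre_Φ₂₁ k L] at hm
  obtain rfl : m = 3 := by omega
  rw [finrank_eq] at hcH hcD
  exact ⟨c, hcQ, hcH, hcD⟩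

/-- **Every realisation of `(ℚ(ζ₂₁); Φ₂₁)` is a SIMPLE abelian variety** — `Φ₂₁` is primitive (`separating_Φ₂₁`) and
"the abelian varieties of [a primitive] type are simple" (Shimura §8.2 Prop. 26, ⟸, the tree theorem
`ComplexMultiplication.isSimple_of_isCMTypeRealisation_of_primitive`). [cite: Shimura1998, §8.2 Prop. 26] -/
theorem isSimple_Φ₂₁ (hA : IsCMTypeRealisation (Φ₂₁ L) A ι θ) : A.IsSimple :=
  Literature.AlgebraicGeometry.ComplexMultiplication.isSimple_of_isCMTypeRealisation_of_primitive hA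
    (separating_Φ₂₁ L)

/-- `dim A = 6` for a realisation of `(ℚ(ζ₂₁); Φ₂₁)` (`[ℚ(ζ₂₁) : ℚ] = 12`). [cite: Shimura1998, §6.2 Theorem 3] -/
theorem dim_eq_six (hA : IsCMTypeRealisation (Φ₂₁ L) A ι θ) : A.dim = 6 := by
  have h := Motives.schemeDim_eq_holds hA.1
  rw [finrank_eq L] at h
  exact h

/-! ### §7 A simple CM sixfold with `B³ ≠ D³` from the existence record -/

/-- **Simple abelian SIXFOLDS with complex multiplication by the ABELIAN field `ℚ(ζ₂₁)` and `B³ ≠ D³`, derived from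
the existence of CM abelian varieties of prescribed type** (Shimura 1998 §6.2 Thm. 3, the tree's record
`PicardCM.CMAbelianVarietyRealised`): a realisation `A` of the primitive, degenerate type `(ℚ(ζ₂₁); Φ₂₁)` is simple
of dimension `6` and carries a rational `(3,3)`-class outside the ring generated by divisor classes — the
dimension-`6`, cyclotomic analogue of Mumford's simple fourfolds (Pohlmann 1968 §3; van Geemen Thm. 4.5; barrier
fact `Barriers.HodgeConjecture.Mumford1968_simpleFourfold_exceptionalHodgeClasses`), by the same mechanism
(`ℚ(√-3) ⊂ ℚ(ζ₂₁)` acts with multiplicities `(3,3)`: Gordon 5.13 (ii), van Geemen 4.7).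
[cite: vanGeemen1994HodgeAV, Thm. 4.5 and 4.7] [cite: Pohlmann1968, §3] [cite: Shimura1998, §6.2 Theorem 3] -/
theorem exists_simple_sixfold_exceptionalHodgeClasses_of_cmAbelianVarietyRealised
    (hreal : Literature.NumberTheory.Automorphic.PicardCM.CMAbelianVarietyRealised) :
    ∃ A : AbelianVariety ℂ, A.IsSimple ∧ A.dim = 6 ∧ Motives.IsSmoothProjective 6 A.X ∧
      ∃ c : complexBetti A.X (2 * 3), IsRationalClass c ∧ IsOfHodgeType 6 A.X (2 * 3) 3 3 c ∧
        c ∉ divisorClassesSpan A.X 6 3 := by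
  haveI : IsCyclotomicExtension {21} ℚ (CyclotomicField 21 ℚ) := CyclotomicField.isCyclotomicExtension 21 ℚ
  haveI : NumberField (CyclotomicField 21 ℚ) := IsCyclotomicExtension.numberField {21} ℚ _
  haveI := isCMField (CyclotomicField 21 ℚ)
  obtain ⟨A, ι, θ, hA⟩ := hreal (CyclotomicField 21 ℚ) (Φ₂₁ _)
  refine ⟨A, isSimple_Φ₂₁ hA, dim_eq_six hA, ?_, exists_exceptional_Φ₂₁ hA⟩
  rw [← dim_eq_six hA]
  exact Motives.AbelianVariety.isSmoothProjective_holds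

end Consequences

/-! ### §8 Yanai's bound for `Φ₂₁`: `Rank(Φ₂₁) ≤ 6` -/

section RankBound

open Literature.NumberTheory.ComplexMultiplication

variable (L : Type) [Field L] [NumberField L] [IsCyclotomicExtension {21} ℚ L]

/-- **`Rank(Φ₂₁) ≤ 6 = n`** — the index of degeneracy `n + 1 − Rank(Φ₂₁)` is at least `1 = [ℚ(√-3) : ℚ]/2`:
Yanai's bound `cmTypeRank_add_card_le_of_fibres_balanced` (file `WeilTypeCMSubfieldRankBound`) for the subfield
`ℚ(ζ₃) ⊂ ℚ(ζ₂₁)` over which `Φ₂₁` is balanced, and one non-real embedding of `ℚ(ζ₃)`.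
[cite: Gordon1999HodgeAVSurvey, §9.4.3 (Theorem [B.140], Yanai 1994)] -/
theorem cmTypeRank_Φ₂₁_le : cmTypeRank (Φ₂₁ L) ≤ 6 := by
  haveI := isCyclotomicExtension_cyclotomicField_three
  haveI := numberField_cyclotomicField_three
  haveI := isCMField L
  set k := CyclotomicField 3 ℚ
  obtain ⟨σ, -⟩ := exists_exp₂₁_eq L 1 (by decide)
  have h := cmTypeRank_add_card_le_of_fibres_balanced (j₃ k L) (fibres_balanced_Φ₂₁ k L) {σ.comp (j₃ k L)}
    (fun τ hτ τ' hτ' => by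
      rw [Finset.mem_singleton] at hτ hτ'
      rw [hτ, hτ']
      exact conjugate_ne k _)
  rw [Finset.card_singleton, finrank_eq L] at h
  omega

/-- The indicator of a translate of `Φ₂₁`, read on exponents: `[τσ ∈ Φ₂₁] = [u(τ)·e(σ) ∈ S]`. [folklore] -/
private theorem translateInd_Φ₂₁ (τ : ℂ ≃+* ℂ) (σ : L →+* ℂ) :
    translateInd (Φ₂₁ L).1 τ σ = if autExp 21 τ * exp₂₁ L σ ∈ S₂₁ then (1 : ℚ) else 0 := by
  have h : τ • σ ∈ (Φ₂₁ L).1 ↔ autExp 21 τ * exp₂₁ L σ ∈ S₂₁ := by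
    rw [ringEquiv_smul_def, RingEquiv.toRingHom_eq_coe, mem_Φ₂₁_iff, exp₂₁_comp]
  by_cases hm : autExp 21 τ * exp₂₁ L σ ∈ S₂₁
  · rw [translateInd_of_mem (h.2 hm), if_pos hm]
  · rw [translateInd_of_not_mem (fun h' => hm (h.1 h')), if_neg hm]

/-- **`Rank(Φ₂₁) ≥ 6`**: the translates of `Φ₂₁` by automorphisms with cyclotomic characters `4, 5, 2, 1, 8, 11`,
evaluated at the embeddings with exponents `1, 5, 4, 8, 19, 20`, form a unitriangular `6 × 6` matrix, so six Galois
translates of `Φ₂₁` are linearly independent (Dodson's `Rank(Φ)`, computed by hand on `(ℤ/21)ˣ`).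
[cite: Dodson1987, §1.1 (p. 50)] -/
theorem six_le_cmTypeRank_Φ₂₁ : 6 ≤ cmTypeRank (Φ₂₁ L) := by
  classical
  have hu : ∀ i : Fin 6, ((![4, 5, 2, 1, 8, 11] : Fin 6 → ZMod 21) i).val.Coprime 21 := by decide
  have hc : ∀ j : Fin 6, ((![1, 5, 4, 8, 19, 20] : Fin 6 → ZMod 21) j).val.Coprime 21 := by decide
  have key0 : ∀ i j : Fin 6, i < j →
      (![4, 5, 2, 1, 8, 11] : Fin 6 → ZMod 21) i * (![1, 5, 4, 8, 19, 20] : Fin 6 → ZMod 21) j ∉ S₂₁ := by decide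
  have key1 : ∀ i : Fin 6,
      (![4, 5, 2, 1, 8, 11] : Fin 6 → ZMod 21) i * (![1, 5, 4, 8, 19, 20] : Fin 6 → ZMod 21) i ∈ S₂₁ := by decide
  choose τ hτ using fun i : Fin 6 => exists_autExp_eq 21 _ (hu i)
  choose σ hσ using fun j : Fin 6 => exists_exp₂₁_eq L _ (hc j)
  let f : Fin 6 → (L →+* ℂ) → ℚ := fun i => translateInd (Φ₂₁ L).1 (τ i)
  have hval : ∀ i j : Fin 6, f i (σ j) =
      if (![4, 5, 2, 1, 8, 11] : Fin 6 → ZMod 21) i * (![1, 5, 4, 8, 19, 20] : Fin 6 → ZMod 21) j ∈ S₂₁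
      then (1 : ℚ) else 0 := by
    intro i j
    show translateInd (Φ₂₁ L).1 (τ i) (σ j) = _
    rw [translateInd_Φ₂₁, hτ, hσ]
  have hzero : ∀ i j : Fin 6, i < j → f i (σ j) = 0 := fun i j hij => by
    rw [hval, if_neg (key0 i j hij)]
  have hone : ∀ i : Fin 6, f i (σ i) = 1 := fun i => by rw [hval, if_pos (key1 i)]
  have hli : LinearIndependent ℚ f := by
    rw [Fintype.linearIndependent_iff]
    intro g hg
    have heval : ∀ j : Fin 6, ∑ i, g i * f i (σ j) = 0 := fun j => by
      have := congrFun hg (σ j)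
      simpa only [Finset.sum_apply, Pi.smul_apply, smul_eq_mul, Pi.zero_apply] using this
    have step : ∀ j : Fin 6, (∀ k : Fin 6, j < k → g k = 0) → g j = 0 := by
      intro j hk
      have h := heval j
      rw [Finset.sum_eq_single j (fun i _ hij => ?_) (fun h => absurd (Finset.mem_univ j) h), hone, mul_one] at h
      · exact h
      · rcases lt_or_gt_of_ne hij with hlt | hgt
        · rw [hzero i j hlt, mul_zero]
        · rw [hk i hgt, zero_mul]
    have hall : ∀ n : ℕ, ∀ j : Fin 6, 6 - n ≤ j.val → g j = 0 := by
      intro n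
      induction n with
      | zero => intro j hj; exact absurd j.isLt (by omega)
      | succ n ih => intro j hj; exact step j fun k hk => ih k (by rw [Fin.lt_def] at hk; omega)
    intro i
    exact hall 6 i (by omega)
  have h1 : Module.finrank ℚ (Submodule.span ℚ (Set.range f)) = 6 := by
    rw [finrank_span_eq_card hli, Fintype.card_fin]
  have h2 : Submodule.span ℚ (Set.range f) ≤
      Submodule.span ℚ (Set.range fun g : ℂ ≃+* ℂ => translateInd (Φ₂₁ L).1 g) :=
    Submodule.span_mono (by rintro _ ⟨i, rfl⟩; exact ⟨τ i, rfl⟩)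
  have h3 := Submodule.finrank_mono h2
  rw [h1] at h3
  exact h3

/-- **`Rank(Φ₂₁) = 6`**: the index of degeneracy of `(ℚ(ζ₂₁); Φ₂₁)` is exactly `1 = [ℚ(√-3):ℚ]/2` — Yanai's bound
`d + 1 − rank S ≥ d₁` is attained. [cite: Gordon1999HodgeAVSurvey, §9.4.3 (Theorem [B.140], Yanai 1994)] -/
theorem cmTypeRank_Φ₂₁ : cmTypeRank (Φ₂₁ L) = 6 :=
  le_antisymm (cmTypeRank_Φ₂₁_le L) (six_le_cmTypeRank_Φ₂₁ L)

end RankBound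

end Cyclotomic

end Literature.AlgebraicGeometry.Pohlmann1968

end
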